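/-
Copyright (c) 2026. All rights reserved.
Released under Apache 2.0 license as described in the file LICENSE.
Authors: abc-iut cell, prover seat abc-iut-L6-t14 (wave 2).
-/
import Literature.NumberTheory.GaloisRepresentations.NormUniformizer
import HarnessLib

/-!
# The unit ball of a locally compact ultrametric normed field is `𝔪`-adically complete and Henselian

Topic `NumberTheory/GaloisRepresentations`, namespace
`Literature.NumberTheory.GaloisRepresentations.Ultrametric` (as `NormUniformizer.lean`, whose
`isDiscreteValuationRing_integer` this file continues). Setting: the NORM-side description of a
nonarchimedean local field, `[NontriviallyNormedField F] [IsUltrametricDist F] [ProperSpace F]`, with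
the norm-induced valuation (`NormedField.toValued`, scoped instance) and its valuation ring
`𝒪 = Valued.integer F = {‖x‖ ≤ 1}` — the setting in which the abc-iut cell types mixed-characteristic
local fields (`[NormedAlgebra ℚ_[p] K]`, `Literature.IUT.LogVolume.*`) and [AbsTopIII]-style
log-shells. Mathlib proves `IsAdicComplete 𝓂[K] 𝒪[K]` only for its valuation-side class
`IsNonarchimedeanLocalField`, and the tree so far only for completions of Dedekind domains
(`Literature.RingTheory.DiscreteValuationRing.AdicCompletionHensel`). This file supplies the norm-side
statements, so that Hensel-type results stated over `[IsAdicComplete (maximalIdeal O) O]` (Mathlib's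
`IsAdicComplete.henselianRing`; the positive-slope several-variable version
`Literature.RingTheory.HenselLemma.exists_eval_det_smul_eq` and [AbsTopII] Lemma 2.1) apply to `𝒪`:

* `mem_maximalIdeal_pow_integer_iff` — `x ∈ 𝔪ⁿ ↔ ‖x‖ ≤ ‖ϖ‖ⁿ` for an irreducible `ϖ ∈ 𝒪`
  (Serre, *Local Fields*, Ch. II §1);
* `isAdicComplete_integer` — `IsAdicComplete (maximalIdeal 𝒪) 𝒪`: a sequence Cauchy for the
  filtration `(𝔪ⁿ)` is Cauchy in `F` (`‖ϖ‖ⁿ → 0`), converges in the complete field `F`, and the limit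
  lies in the closed sets `𝒪` and `f n + 𝔪ⁿ`;
* `henselianLocalRing_integer` — `𝒪` is a Henselian local ring (Cassels, *Local Fields*, Ch. 4,
  Lemma 3.1), from Mathlib's `IsAdicComplete.henselianRing`.

Everything is proved; nothing is asserted.
-/

noncomputable section

open Metric Filter
open _root_.Topology

namespace Literature.NumberTheory.GaloisRepresentations.Ultrametric

open scoped NormedField

variable {F : Type*} [NontriviallyNormedField F] [IsUltrametricDist F]

/-- In the valuation ring `𝒪 = {‖x‖ ≤ 1}` of a locally compact ultrametric normed field, membership
in a power of the maximal ideal is read off from the norm: `x ∈ 𝔪ⁿ ↔ ‖x‖ ≤ ‖ϖ‖ⁿ` for any irreducible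
`ϖ` of `𝒪` (`𝔪ⁿ = (ϖⁿ)`, and divisibility in a valuation ring is comparison of valuations).
[cite: SerreLocalFields1979, Ch. II §1] -/
theorem mem_maximalIdeal_pow_integer_iff [ProperSpace F] {ϖ : Valued.integer F}
    (hϖ : Irreducible ϖ) (n : ℕ) (x : Valued.integer F) :
    x ∈ IsLocalRing.maximalIdeal (Valued.integer F) ^ n ↔ ‖(x : F)‖ ≤ ‖(ϖ : F)‖ ^ n := by
  haveI := isDiscreteValuationRing_integer (F := F)
  have hv : (Valued.v : Valuation F NNReal).Integers (Valued.integer F) :=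
    Valuation.integer.integers _
  rw [hϖ.maximalIdeal_eq, Ideal.span_singleton_pow, Ideal.mem_span_singleton, ← hv.le_iff_dvd]
  show ‖(x : F)‖₊ ≤ ‖((ϖ ^ n : Valued.integer F) : F)‖₊ ↔ _
  rw [SubmonoidClass.coe_pow, ← NNReal.coe_le_coe, coe_nnnorm, coe_nnnorm, norm_pow]

/-- An irreducible element of `𝒪` has norm `< 1` (it is not a unit of the valuation ring).
[cite: SerreLocalFields1979, Ch. II §1] -/
theorem norm_lt_one_of_irreducible [ProperSpace F] {ϖ : Valued.integer F} (hϖ : Irreducible ϖ) :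
    ‖(ϖ : F)‖ < 1 := by
  have hle : ‖(ϖ : F)‖ ≤ 1 := Valued.integer.mem_iff.mp ϖ.2
  rcases hle.lt_or_eq with h | h
  · exact h
  · exfalso
    apply hϖ.not_isUnit
    have hv : (Valued.v : Valuation F NNReal).Integers (Valued.integer F) :=
      Valuation.integer.integers _
    have hϖ0 : (ϖ : F) ≠ 0 := fun h0 => hϖ.ne_zero (Subtype.ext h0)
    refine hv.isUnit_of_one (isUnit_iff_ne_zero.mpr hϖ0) ?_
    show ‖(ϖ : F)‖₊ = 1
    rw [← NNReal.coe_inj, coe_nnnorm, NNReal.coe_one]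
    exact h

/-- **`𝒪 = {‖x‖ ≤ 1}` is `𝔪`-adically complete** for a locally compact ultrametric normed field:
`IsAdicComplete (maximalIdeal 𝒪) 𝒪`. Hausdorff: `x ∈ ⋂ 𝔪ⁿ` forces `‖x‖ ≤ ‖ϖ‖ⁿ → 0`. Precomplete:
a sequence Cauchy for `(𝔪ⁿ)` is Cauchy in the complete field `F`; its limit lies in the closed ball
`𝒪` and in each closed ball `f n + 𝔪ⁿ` (Serre, *Local Fields*, Ch. II §1, `𝒪 = lim 𝒪/𝔪ⁿ`).
[cite: SerreLocalFields1979, Ch. II §1] -/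
theorem isAdicComplete_integer [ProperSpace F] :
    IsAdicComplete (IsLocalRing.maximalIdeal (Valued.integer F)) (Valued.integer F) := by
  haveI := isDiscreteValuationRing_integer (F := F)
  obtain ⟨ϖ, hϖ⟩ := IsDiscreteValuationRing.exists_irreducible (Valued.integer F)
  have hϖ1 : ‖(ϖ : F)‖ < 1 := norm_lt_one_of_irreducible hϖ
  have hϖ0 : 0 ≤ ‖(ϖ : F)‖ := norm_nonneg _
  have hmem : ∀ (n : ℕ) (x : Valued.integer F),
      x ∈ IsLocalRing.maximalIdeal (Valued.integer F) ^ n • (⊤ : Ideal (Valued.integer F)) ↔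
        ‖(x : F)‖ ≤ ‖(ϖ : F)‖ ^ n := by
    intro n x
    rw [smul_eq_mul, Ideal.mul_top, mem_maximalIdeal_pow_integer_iff hϖ]
  have hpow : Tendsto (fun n : ℕ => ‖(ϖ : F)‖ ^ n) atTop (𝓝 0) :=
    tendsto_pow_atTop_nhds_zero_of_lt_one hϖ0 hϖ1
  refine { haus' := fun x hx => ?_, prec' := fun f hf => ?_ }
  · -- Hausdorff
    have hx' : ∀ n : ℕ, ‖(x : F)‖ ≤ ‖(ϖ : F)‖ ^ n := fun n => by
      have h := hx n
      rw [SModEq.zero, hmem] at h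
      exact h
    have h0 : ‖(x : F)‖ ≤ 0 := ge_of_tendsto' hpow hx'
    exact Subtype.ext (norm_le_zero_iff.mp h0)
  · -- precomplete
    simp only [SModEq.sub_mem, hmem, AddSubgroupClass.coe_sub] at hf ⊢
    set g : ℕ → F := fun n => (f n : F) with hg
    have hbound : ∀ {N k : ℕ}, N ≤ k → ‖g k - g N‖ ≤ ‖(ϖ : F)‖ ^ N := by
      intro N k hk
      rw [norm_sub_rev]
      exact hf hk
    have hcauchy : CauchySeq g := by
      refine Metric.cauchySeq_iff'.mpr fun ε hε => ?_
      obtain ⟨N, hN⟩ := (Metric.tendsto_atTop.mp hpow) ε hε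
      refine ⟨N, fun k hk => ?_⟩
      rw [dist_eq_norm]
      have h := hN N le_rfl
      rw [dist_zero_right, Real.norm_of_nonneg (pow_nonneg hϖ0 N)] at h
      exact (hbound hk).trans_lt h
    obtain ⟨L, hL⟩ := cauchySeq_tendsto_of_complete hcauchy
    -- the limit lies in the closed unit ball `𝒪`
    have hLmem : L ∈ Valued.integer F := by
      rw [Valued.integer.mem_iff]
      have hclosed : IsClosed {y : F | ‖y‖ ≤ 1} := isClosed_le continuous_norm continuous_const
      exact hclosed.mem_of_tendsto hL (Eventually.of_forall fun n =>
        Valued.integer.mem_iff.mp (f n).2)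
    refine ⟨⟨L, hLmem⟩, fun n => ?_⟩
    -- and in each closed ball `f n + 𝔪ⁿ`
    have hclosed : IsClosed {y : F | ‖y - g n‖ ≤ ‖(ϖ : F)‖ ^ n} :=
      isClosed_le (continuous_norm.comp (continuous_sub_right (g n))) continuous_const
    have hLball : L ∈ {y : F | ‖y - g n‖ ≤ ‖(ϖ : F)‖ ^ n} :=
      hclosed.mem_of_tendsto hL (eventually_atTop.mpr ⟨n, fun k hk => hbound hk⟩)
    rw [norm_sub_rev]
    exact hLball

/-- **`𝒪 = {‖x‖ ≤ 1}` is a Henselian local ring** for a locally compact ultrametric normed field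
(Hensel's lemma; Cassels, *Local Fields*, Ch. 4, Lemma 3.1): from `isAdicComplete_integer` by Mathlib's
`IsAdicComplete.henselianRing`, in the local form (in a local ring "unit mod `𝔪`" = "unit").
[cite: Cassels1986, Ch. 4 Lemma 3.1] -/
theorem henselianLocalRing_integer [ProperSpace F] : HenselianLocalRing (Valued.integer F) := by
  haveI := isDiscreteValuationRing_integer (F := F)
  haveI := isAdicComplete_integer (F := F)
  exact
    { is_henselian := fun f hf a₀ h₁ h₂ =>
        HenselianRing.is_henselian (I := IsLocalRing.maximalIdeal (Valued.integer F)) f hf a₀ h₁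
          (h₂.map _) }

end Literature.NumberTheory.GaloisRepresentations.Ultrametric

end
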